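import Summits.Schanuel.Schanuel.Theorems.RootDecomp1KLevelFinite05

/-!
# RootDecomp1KLevelFinite — lens 1, generation 51 ADDENDUM «BOTH SPLIT CONJUGATE-POLES LEAVES CLOSED: normShapeLF_holds» (§8 SplitGrades) — continuation (RootDecomp1KLevelFinite06): §8.2 resultant data + §8.3 the monicised quadratic in 𝕂

(lens-1 g51 ADDENDUM kernel K″ = HOME/decomp-schanuel-lens-1/g51/LevelFiniteSplit.lean 375ea065…, 2255 l = node-10 K b1fbaeff… VERBATIM (843/843 lines in order; ported as RootDecomp1KLevelFinite01–04) + TWO pure insertions: an addendum module docstring and `§8 section SplitGrades` (K″ l.863–2252, 75 decls); same single import …RootDecomp1KXLinear05; P″ LevelFiniteSplitProbe.lean rc 0 / C₀″ rc 0 / C″ LevelFiniteSplitCtrl.lean rc 1 = 10 planted; ADDENDUM/NODE L2486 / REQUEST L2487, critic VERDICT L2488: CLEARED under RULE K-R40 (ii)/(v) — ONE THEOREM ×1 «CONJUGATE-POLES LEAVES CLOSED: (NormShapeLevels g q a D).Finite for EVERY NormShapeHyp g q a D, uniformly over all grades, by a two-pass 2-adic Ridout argument in PadicAlgCl 2 on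 the tree's `RootDecomp1KXLinearCore.ridout_step`»; writer re-check L2489; PORT GO. Port by census-1 gen 21 of §8 as `RootDecomp1KLevelFinite05–09` continuing the 01–04 chain: 05 = §8.0 norms of integers in `PadicAlgCl 2`, binary forms `hform`, + §8.1 Bezout identities (`cpoly`, `bezout_forms`); 06 = §8.2 resultant data of a conjugate-poles shape + §8.3 the monicised quadratic in 𝕂 (`two_roots`, `ghatc`); 07 = §8.4 one level: integer bookkeeping (`psNumer_le`, `hform_two_eq`, …) + §8.5 the 𝕂-side (`nearest_root`, root extraction, `lamq`); 08 = §8.6 one level: height, arithmetic and the 2-adic closeness (`heightC`, `level_arith`, `level_padic`); 09 = §8.7 assembly **`normShapeLF_holds`** + §8.8 corollaries `normShapeLFSplitImag_holds` / `normShapeLFSplitReal_holds` (the two K binders LITERALLY), `levelFinite_of_siegelShapes''` / `thinFibre_of_siegelShapes''` / `b_of_siegelShapes''` (⟸ `SiegelShapes` ALONE) + §8.9 hyp-free instances `normShapeCurve`, `levelFinite_normShapeCurve`, `levelFinite_sqrt17_curve` (g47's residual (δ) family member DECIDED). PORT EDITS (census convention, pre-sanctioned L2488): `psNumer_pos'`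 privatised (homonym statement of private tree `psNumer_pos`); `isCoprime_num_den` stays private (privatised in 03; private copies where §8 calls it); 24 one-line helper docstrings (statements quoted); `section SplitGrades` with its two `open … (…)` lines closed / re-opened per part, the `open … (bev_map_C)` of §8.9 travels inside 09; statements and proofs otherwise verbatim, no renames, no heartbeat lines. `--supports stmt-Schanuel-33364`; no census credit carried; rung 0 — nothing here proves Schanuel, 33364, 31077, 33363, SiegelShapes, or ThinFibre m₀ / (b) hypothesis-free.)
-/

noncomputable section

open Polynomial LiouvilleNumber
open scoped Nat

namespace Summit.Schanuel.Schanuel.Theorems.RootDecomp1KLevelFinite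

open Summit.Schanuel.Schanuel.Theorems.RootDecomp1KSkelCell (iota SkelLiouville SkelLiouvilleFix
  skelLiouville_iff_fix SkelLiouvilleFix.mono)
open Summit.Schanuel.Schanuel.Theorems.RootDecomp1KTwoBaseCell (psNumer partialSum_eq_psNumer_div coprime_psNumer
  sb_of_range_eq')
open Summit.Schanuel.Schanuel.Theorems.RootDecomp1KRelLiouvilleCell (partialSum_two_strictMono)
open Summit.Schanuel.Schanuel.Theorems.RootDecomp1KDegreeLadder
open Summit.Schanuel.Schanuel.Theorems.RootDecomp1KXLinear (xLinP bev_xLinP aeval_ratCast levels_finite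
  thinFibreAt_mul_left)
open Summit.Schanuel.Schanuel.Theorems.RootDecomp1KHyper (SB SFset sb_of_algebraicIndependent)

section SplitGrades

open Summit.Schanuel.Schanuel.Theorems.RootDecomp1KXLinearCore (roots_structure ridout_step)
open Summit.Schanuel.Schanuel.Theorems.RootDecomp1KXLinear (norm_psNumer_sub_one)

/-! ### §8.2 Resultant data of a conjugate-poles shape: bounded common divisors, bounded height -/

/-- `{q : ℤ[X]} (hq : q.natDegree = 2) : q.coeff 2 ≠ 0`. -/
private theorem coeff_two_ne_zero_of_natDegree {q : ℤ[X]} (hq : q.natDegree = 2) : q.coeff 2 ≠ 0 := by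
  have hq0 : q ≠ 0 := by rintro rfl; simp at hq
  rw [← hq, coeff_natDegree]; exact leadingCoeff_ne_zero.mpr hq0

/-- `{q : ℤ[X]} (hnr : ∀ t : ℚ, aeval t q ≠ 0) : q.coeff 0 ≠ 0`. -/
theorem coeff_zero_ne_zero_of_noRoot {q : ℤ[X]} (hnr : ∀ t : ℚ, aeval t q ≠ 0) : q.coeff 0 ≠ 0 := by
  intro h
  apply hnr 0
  rw [aeval_def, eval₂_at_zero, h, map_zero]

/-- `g ⊥ q` in `ℚ[X]` from «no common complex root». -/
theorem isCoprime_cpoly_of_hyp {g q : ℤ[X]} {a : ℕ} (hq : q.natDegree = 2) (hga : g.natDegree ≤ 2 * a)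
    (hcop : ∀ z : ℂ, aeval z q = 0 → aeval z g ≠ 0) :
    IsCoprime (cpoly g.coeff (2 * a)) (cpoly q.coeff 2) := by
  refine (Polynomial.isCoprime_iff_aeval_ne_zero_of_isAlgClosed (k := ℚ) (K := ℂ) _ _).mpr fun z => ?_
  rw [aeval_cpoly_coeff g hga, aeval_cpoly_coeff q hq.le]
  by_cases hz : aeval z q = 0
  · exact Or.inl (hcop z hz)
  · exact Or.inr hz

/-- reflection–evaluation: `aeval z (Σ c_{n−i} Xⁱ) = zⁿ · aeval z⁻¹ (Σ cᵢ Xⁱ)` for `z ≠ 0`. -/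
theorem aeval_cpoly_reflect {F : Type*} [Field F] [Algebra ℚ F] (c : ℕ → ℤ) (n : ℕ) {z : F} (hz : z ≠ 0) :
    aeval z (cpoly (fun i => c (n - i)) n) = z ^ n * aeval z⁻¹ (cpoly c n) := by
  rw [aeval_cpoly, aeval_cpoly]
  have h1 : ∑ i ∈ Finset.range (n + 1), (c (n - i) : F) * z ^ i = hform (fun i => c (n - i)) n z 1 := by
    simp [hform]
  rw [h1, ← hform_reflect c n (1 : F) z, hform_eq_pow_mul_sum c n 1 z hz]
  simp [one_div]

/-- the REFLECTED pair is coprime too (`q₂ ≠ 0`: no common root at `z = 0`). -/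
theorem isCoprime_cpoly_reflect_of_hyp {g q : ℤ[X]} {a : ℕ} (hq : q.natDegree = 2) (hga : g.natDegree ≤ 2 * a)
    (hcop : ∀ z : ℂ, aeval z q = 0 → aeval z g ≠ 0) :
    IsCoprime (cpoly (fun i => g.coeff (2 * a - i)) (2 * a)) (cpoly (fun i => q.coeff (2 - i)) 2) := by
  refine (Polynomial.isCoprime_iff_aeval_ne_zero_of_isAlgClosed (k := ℚ) (K := ℂ) _ _).mpr fun z => ?_
  by_cases hz0 : z = 0
  · right
    have h2 := coeff_two_ne_zero_of_natDegree hq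
    rw [hz0, aeval_cpoly]
    simp [Finset.sum_range_succ]
    exact_mod_cast h2
  · rw [aeval_cpoly_reflect _ _ hz0, aeval_cpoly_reflect _ _ hz0, aeval_cpoly_coeff g hga,
      aeval_cpoly_coeff q hq.le]
    by_cases hz : aeval z⁻¹ q = 0
    · exact Or.inl (mul_ne_zero (pow_ne_zero _ hz0) (hcop _ hz))
    · exact Or.inr (mul_ne_zero (pow_ne_zero _ hz0) hz)

/-- **Resultant data.**  For a conjugate-poles pair `(g, q)`: a non-zero integer `d` divisible by every common divisor of
`G(u,v)`, `Q(u,v)` at coprime `(u,v)`, and the `v`-chart Bezout identity with height-controlled cofactors. -/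
theorem resultant_data {g q : ℤ[X]} {a : ℕ} (hq : q.natDegree = 2) (hnr : ∀ t : ℚ, aeval t q ≠ 0)
    (hga : g.natDegree ≤ 2 * a) (hcop : ∀ z : ℂ, aeval z q = 0 → aeval z g ≠ 0) :
    ∃ (d : ℤ) (K : ℕ) (Cb : ℝ), d ≠ 0 ∧ 2 * a ≤ K ∧ 2 ≤ K ∧ 0 < Cb ∧
      ∀ u v : ℤ, v ≠ 0 →
        (IsCoprime u v → ∀ m : ℤ, m ∣ hform g.coeff (2 * a) u v → m ∣ hform q.coeff 2 u v → m ∣ d) ∧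
        (∃ d₁ A B : ℤ, d₁ ≠ 0 ∧ A * hform g.coeff (2 * a) u v + B * hform q.coeff 2 u v = d₁ * v ^ K ∧
          |(A : ℝ)| ≤ Cb * (max |(u : ℝ)| |(v : ℝ)|) ^ (K - 2 * a) ∧
          |(B : ℝ)| ≤ Cb * (max |(u : ℝ)| |(v : ℝ)|) ^ (K - 2)) := by
  obtain ⟨d₁, K₁, C₁, hd₁, hK₁a, hK₁b, hC₁, hF₁⟩ :=
    bezout_forms _ _ _ _ (isCoprime_cpoly_of_hyp hq hga hcop)
  obtain ⟨d₂, K₂, C₂, hd₂, hK₂a, hK₂b, hC₂, hF₂⟩ :=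
    bezout_forms _ _ _ _ (isCoprime_cpoly_reflect_of_hyp hq hga hcop)
  have hq0 := coeff_zero_ne_zero_of_noRoot hnr
  refine ⟨d₁ * d₂ * q.coeff 0, K₁, C₁, mul_ne_zero (mul_ne_zero hd₁ hd₂) hq0, hK₁a, hK₁b, hC₁, ?_⟩
  intro u v hv
  obtain ⟨A, B, hAB, hA, hB⟩ := hF₁ u v hv
  refine ⟨fun huv m hmG hmQ => ?_, ⟨d₁, A, B, hd₁, hAB, hA, hB⟩⟩
  by_cases hu : u = 0
  · -- `u = 0`: `v = ±1` and `Q(0, v) = q₀ v² = q₀`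
    subst hu
    have hvu : IsUnit v := isCoprime_zero_left.mp huv
    have hv2 : v ^ 2 = 1 := by
      rcases Int.isUnit_iff.mp hvu with h | h <;> simp [h]
    have hQ : hform q.coeff 2 (0 : ℤ) v = q.coeff 0 := by
      simp [hform, Finset.sum_range_succ, hv2]
    rw [hQ] at hmQ
    exact Dvd.dvd.mul_left hmQ _
  · obtain ⟨A', B', hAB', -, -⟩ := hF₂ v u hu
    rw [← hform_reflect g.coeff (2 * a) u v, ← hform_reflect q.coeff 2 u v] at hAB'
    have h1 : m ∣ d₁ * v ^ K₁ := by
      rw [← hAB]; exact dvd_add (Dvd.dvd.mul_left hmG _) (Dvd.dvd.mul_left hmQ _)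
    have h2 : m ∣ d₂ * u ^ K₂ := by
      rw [← hAB']; exact dvd_add (Dvd.dvd.mul_left hmG _) (Dvd.dvd.mul_left hmQ _)
    obtain ⟨x, y, hxy⟩ := (IsCoprime.pow huv : IsCoprime (u ^ K₂) (v ^ K₁))
    have h3 : m ∣ d₁ * d₂ := by
      have : d₁ * d₂ = x * d₁ * (d₂ * u ^ K₂) + y * d₂ * (d₁ * v ^ K₁) := by
        linear_combination (-(d₁ : ℤ) * d₂) * hxy
      rw [this]
      exact dvd_add (Dvd.dvd.mul_left h2 _) (Dvd.dvd.mul_left h1 _)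
    exact Dvd.dvd.mul_right h3 _

/-- HEIGHT, `v`-dominant chart: from the Bezout identity, `|G| ≤ C_G |Q|^a` and `H ≤ λ|v|`, get `|v|² ≤ C·|Q|`. -/
theorem sq_le_of_vchart {G Q A B d₁ v : ℤ} {a K : ℕ} {Cb CG lam H : ℝ} (hCb : 0 < Cb) (hCG : 0 ≤ CG)
    (hlam : 1 ≤ lam) (hd₁ : d₁ ≠ 0) (h2a : 2 * a ≤ K) (h2 : 2 ≤ K) (ha : 1 ≤ a) (hv : v ≠ 0) (hQ : Q ≠ 0)
    (hid : A * G + B * Q = d₁ * v ^ K) (hA : |(A : ℝ)| ≤ Cb * H ^ (K - 2 * a))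
    (hB : |(B : ℝ)| ≤ Cb * H ^ (K - 2)) (hH0 : 0 ≤ H) (hHv : H ≤ lam * |(v : ℝ)|)
    (hGQ : |(G : ℝ)| ≤ CG * |(Q : ℝ)| ^ a) :
    |(v : ℝ)| ^ 2 ≤ max 1 (Cb * lam ^ K * (CG + 1)) * |(Q : ℝ)| := by
  have hvpos : 0 < |(v : ℝ)| := abs_pos.mpr (by exact_mod_cast hv)
  have hQpos : 0 < |(Q : ℝ)| := abs_pos.mpr (by exact_mod_cast hQ)
  have hQ1 : 1 ≤ |(Q : ℝ)| := by
    rw [← Int.cast_abs]; exact_mod_cast Int.one_le_abs hQ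
  by_cases hcase : |(v : ℝ)| ^ 2 ≤ |(Q : ℝ)|
  · calc |(v : ℝ)| ^ 2 ≤ |(Q : ℝ)| := hcase
      _ = 1 * |(Q : ℝ)| := (one_mul _).symm
      _ ≤ max 1 (Cb * lam ^ K * (CG + 1)) * |(Q : ℝ)| := by gcongr; exact le_max_left _ _
  · have hlt : |(Q : ℝ)| < |(v : ℝ)| ^ 2 := lt_of_not_ge hcase
    -- `|v|^K ≤ |d₁ v^K| ≤ |A||G| + |B||Q|`
    have hd1 : (1 : ℝ) ≤ |(d₁ : ℝ)| := by
      rw [← Int.cast_abs]; exact_mod_cast Int.one_le_abs hd₁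
    have hmain : |(v : ℝ)| ^ K ≤ |(A : ℝ)| * |(G : ℝ)| + |(B : ℝ)| * |(Q : ℝ)| := by
      have h1 : ((A * G + B * Q : ℤ) : ℝ) = d₁ * v ^ K := by exact_mod_cast hid
      push_cast at h1
      calc |(v : ℝ)| ^ K = 1 * |(v : ℝ)| ^ K := (one_mul _).symm
        _ ≤ |(d₁ : ℝ)| * |(v : ℝ)| ^ K := by gcongr
        _ = |(A : ℝ) * G + B * Q| := by rw [h1, abs_mul, abs_pow]
        _ ≤ |(A : ℝ) * G| + |(B : ℝ) * Q| := abs_add_le _ _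
        _ = _ := by rw [abs_mul, abs_mul]
    -- powers of `H` against powers of `|v|`
    have hHK : ∀ j : ℕ, j ≤ K → H ^ j ≤ lam ^ K * |(v : ℝ)| ^ j := by
      intro j hj
      calc H ^ j ≤ (lam * |(v : ℝ)|) ^ j := by gcongr
        _ = lam ^ j * |(v : ℝ)| ^ j := mul_pow _ _ _
        _ ≤ lam ^ K * |(v : ℝ)| ^ j := by gcongr
    -- `|Q|^a ≤ |Q| · |v|^{2(a-1)}`
    have hQa : |(Q : ℝ)| ^ a ≤ |(Q : ℝ)| * |(v : ℝ)| ^ (2 * (a - 1)) := by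
      obtain ⟨a', rfl⟩ : ∃ a', a = a' + 1 := ⟨a - 1, by omega⟩
      rw [pow_succ, Nat.add_sub_cancel, mul_comm]
      gcongr
      calc |(Q : ℝ)| ^ a' ≤ (|(v : ℝ)| ^ 2) ^ a' := by gcongr
        _ = |(v : ℝ)| ^ (2 * a') := by rw [← pow_mul]
    have hstep : |(v : ℝ)| ^ K ≤ Cb * lam ^ K * (CG + 1) * (|(v : ℝ)| ^ (K - 2) * |(Q : ℝ)|) := by
      calc |(v : ℝ)| ^ K ≤ |(A : ℝ)| * |(G : ℝ)| + |(B : ℝ)| * |(Q : ℝ)| := hmain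
        _ ≤ (Cb * H ^ (K - 2 * a)) * (CG * |(Q : ℝ)| ^ a) + (Cb * H ^ (K - 2)) * |(Q : ℝ)| := by
            gcongr
        _ ≤ (Cb * (lam ^ K * |(v : ℝ)| ^ (K - 2 * a))) * (CG * (|(Q : ℝ)| * |(v : ℝ)| ^ (2 * (a - 1))))
            + (Cb * (lam ^ K * |(v : ℝ)| ^ (K - 2))) * |(Q : ℝ)| := by
            gcongr
            · exact hHK _ (by omega)
            · exact hHK _ (by omega)
        _ = Cb * lam ^ K * (CG + 1) * (|(v : ℝ)| ^ (K - 2) * |(Q : ℝ)|) := by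
            have : |(v : ℝ)| ^ (K - 2 * a) * |(v : ℝ)| ^ (2 * (a - 1)) = |(v : ℝ)| ^ (K - 2) := by
              rw [← pow_add]; congr 1; omega
            rw [show Cb * (lam ^ K * |(v : ℝ)| ^ (K - 2 * a)) * (CG * (|(Q : ℝ)| * |(v : ℝ)| ^ (2 * (a - 1))))
                = Cb * lam ^ K * CG * |(Q : ℝ)| * (|(v : ℝ)| ^ (K - 2 * a) * |(v : ℝ)| ^ (2 * (a - 1))) by ring,
              this]
            ring
    have hK' : |(v : ℝ)| ^ K = |(v : ℝ)| ^ (K - 2) * |(v : ℝ)| ^ 2 := by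
      rw [← pow_add]; congr 1; omega
    rw [hK'] at hstep
    have hvK : 0 < |(v : ℝ)| ^ (K - 2) := pow_pos hvpos _
    have : |(v : ℝ)| ^ 2 ≤ Cb * lam ^ K * (CG + 1) * |(Q : ℝ)| := by
      have hstep' : |(v : ℝ)| ^ (K - 2) * |(v : ℝ)| ^ 2
          ≤ |(v : ℝ)| ^ (K - 2) * (Cb * lam ^ K * (CG + 1) * |(Q : ℝ)|) := by
        calc _ ≤ _ := hstep
          _ = _ := by ring
      exact le_of_mul_le_mul_left hstep' hvK
    calc |(v : ℝ)| ^ 2 ≤ Cb * lam ^ K * (CG + 1) * |(Q : ℝ)| := this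
      _ ≤ max 1 (Cb * lam ^ K * (CG + 1)) * |(Q : ℝ)| := by gcongr; exact le_max_right _ _

/-- HEIGHT, `u`-dominant chart: if `|u| ≥ λ|v|`, `λ = 2(|q₁| + |q₀|) + 2`, then `u² ≤ 2|Q(u,v)|` (`|q₂| ≥ 1`). -/
theorem sq_le_of_uchart {q : ℤ[X]} (hq : q.natDegree = 2) (u v : ℤ)
    (huv : (2 * (|(q.coeff 1 : ℝ)| + |(q.coeff 0 : ℝ)|) + 2) * |(v : ℝ)| ≤ |(u : ℝ)|) :
    |(u : ℝ)| ^ 2 ≤ 2 * |((hform q.coeff 2 u v : ℤ) : ℝ)| := by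
  have h2 := coeff_two_ne_zero_of_natDegree hq
  have hq2 : (1 : ℝ) ≤ |(q.coeff 2 : ℝ)| := by
    rw [← Int.cast_abs]; exact_mod_cast Int.one_le_abs h2
  have hQ : ((hform q.coeff 2 u v : ℤ) : ℝ) = q.coeff 2 * u ^ 2 + (q.coeff 1 * u * v + q.coeff 0 * v ^ 2) := by
    rw [hform_intCast]; simp [hform, Finset.sum_range_succ]; ring
  rw [hQ]
  set L : ℝ := |(q.coeff 1 : ℝ)| + |(q.coeff 0 : ℝ)| with hL
  have hL0 : 0 ≤ L := by positivity
  have hv0 : 0 ≤ |(v : ℝ)| := abs_nonneg _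
  have hu0 : 0 ≤ |(u : ℝ)| := abs_nonneg _
  have hvu : |(v : ℝ)| ≤ |(u : ℝ)| := by nlinarith
  -- the perturbation is at most `u²/2`
  have hpert : |(q.coeff 1 : ℝ) * u * v + q.coeff 0 * v ^ 2| ≤ |(u : ℝ)| ^ 2 / 2 := by
    calc |(q.coeff 1 : ℝ) * u * v + q.coeff 0 * v ^ 2|
        ≤ |(q.coeff 1 : ℝ) * u * v| + |(q.coeff 0 : ℝ) * v ^ 2| := abs_add_le _ _
      _ = |(q.coeff 1 : ℝ)| * |(u : ℝ)| * |(v : ℝ)| + |(q.coeff 0 : ℝ)| * |(v : ℝ)| * |(v : ℝ)| := by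
          rw [abs_mul, abs_mul, abs_mul, abs_pow, pow_two]; ring
      _ ≤ |(q.coeff 1 : ℝ)| * |(u : ℝ)| * |(v : ℝ)| + |(q.coeff 0 : ℝ)| * |(u : ℝ)| * |(v : ℝ)| := by
          gcongr
      _ = L * (|(u : ℝ)| * |(v : ℝ)|) := by rw [hL]; ring
      _ ≤ |(u : ℝ)| ^ 2 / 2 := by
          rw [pow_two]
          have : (2 * L + 2) * (|(u : ℝ)| * |(v : ℝ)|) ≤ |(u : ℝ)| * |(u : ℝ)| := by nlinarith
          nlinarith
  have hmainT : |(q.coeff 2 : ℝ)| * |(u : ℝ)| ^ 2 - |(u : ℝ)| ^ 2 / 2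
      ≤ |(q.coeff 2 : ℝ) * u ^ 2 + (q.coeff 1 * u * v + q.coeff 0 * v ^ 2)| := by
    have := abs_sub_abs_le_abs_sub ((q.coeff 2 : ℝ) * u ^ 2) (-(q.coeff 1 * u * v + q.coeff 0 * v ^ 2))
    rw [sub_neg_eq_add, abs_neg, abs_mul, abs_pow] at this
    linarith
  nlinarith [abs_nonneg ((u : ℝ))]

/-! ### §8.3 The monicised quadratic `X² + q₁X + q₀q₂` in `𝕂 = PadicAlgCl 2`: two roots, factorisation, `ĝ(θ) ≠ 0` -/

/-- `{S : Type*} [CommRing S] [Algebra ℤ S] {q : ℤ[X]} (hq : q.natDegree = 2) (x : S) : aeval x q = (q.coeff 2 : S) * x ^ 2 + (q.coeff 1 : S) * x + (q.coeff 0 : S)`. -/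
theorem aeval_quadratic {S : Type*} [CommRing S] [Algebra ℤ S] {q : ℤ[X]} (hq : q.natDegree = 2) (x : S) :
    aeval x q = (q.coeff 2 : S) * x ^ 2 + (q.coeff 1 : S) * x + (q.coeff 0 : S) := by
  rw [← sum_coeff_eq_aeval q hq.le x]
  simp [Finset.sum_range_succ]
  ring

/-- the discriminant of `q` is non-zero (else `−q₁/(2q₂)` is a rational root). -/
theorem disc_ne_zero {q : ℤ[X]} (hq : q.natDegree = 2) (hnr : ∀ t : ℚ, aeval t q ≠ 0) :
    (q.coeff 1 : ℚ) ^ 2 - 4 * (q.coeff 0 : ℚ) * (q.coeff 2 : ℚ) ≠ 0 := by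
  intro hdisc
  have h2 : (q.coeff 2 : ℚ) ≠ 0 := by exact_mod_cast coeff_two_ne_zero_of_natDegree hq
  apply hnr (-(q.coeff 1 : ℚ) / (2 * q.coeff 2))
  rw [aeval_quadratic hq]
  field_simp
  linear_combination (-1 : ℚ) * hdisc

/-- an element of `𝕂` satisfying a monic integer quadratic has norm `≤ 1`. -/
theorem normK_le_one_of_quadratic {θ : PadicAlgCl 2} {b c : ℤ}
    (h : θ ^ 2 + (b : PadicAlgCl 2) * θ + (c : PadicAlgCl 2) = 0) : ‖θ‖ ≤ 1 := by
  by_contra H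
  have H' : 1 < ‖θ‖ := lt_of_not_ge H
  have h1 : θ ^ 2 = -((b : PadicAlgCl 2) * θ + (c : PadicAlgCl 2)) := by linear_combination h
  have h2 : ‖θ‖ ^ 2 ≤ ‖θ‖ := by
    calc ‖θ‖ ^ 2 = ‖θ ^ 2‖ := (norm_pow _ _).symm
      _ = ‖(b : PadicAlgCl 2) * θ + (c : PadicAlgCl 2)‖ := by rw [h1, norm_neg]
      _ ≤ max ‖(b : PadicAlgCl 2) * θ‖ ‖(c : PadicAlgCl 2)‖ := IsUltrametricDist.norm_add_le_max _ _
      _ ≤ max ‖θ‖ 1 := by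
          gcongr
          · rw [norm_mul]
            calc ‖(b : PadicAlgCl 2)‖ * ‖θ‖ ≤ 1 * ‖θ‖ := by gcongr; exact normK_intCast_le_one b
              _ = ‖θ‖ := one_mul _
          · exact normK_intCast_le_one c
      _ = ‖θ‖ := max_eq_left H'.le
  nlinarith

/-- **Two roots.**  `X² + q₁X + q₀q₂` has roots `θ₁ ≠ θ₂` in `\overline{ℚ₂}`, of norm `≤ 1`, algebraic over `ℚ`,
with `θ₁ + θ₂ = −q₁`, `θ₁θ₂ = q₀q₂`. -/
theorem two_roots {q : ℤ[X]} (hq : q.natDegree = 2) (hnr : ∀ t : ℚ, aeval t q ≠ 0) :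
    ∃ θ₁ θ₂ : PadicAlgCl 2,
      θ₁ + θ₂ = -(q.coeff 1 : PadicAlgCl 2) ∧ θ₁ * θ₂ = (q.coeff 0 : PadicAlgCl 2) * (q.coeff 2 : PadicAlgCl 2) ∧
      θ₁ ≠ θ₂ ∧ ‖θ₁‖ ≤ 1 ∧ ‖θ₂‖ ≤ 1 ∧ IsAlgebraic ℚ θ₁ ∧ IsAlgebraic ℚ θ₂ ∧
      (θ₁ ^ 2 + (q.coeff 1 : PadicAlgCl 2) * θ₁ + ((q.coeff 0 * q.coeff 2 : ℤ) : PadicAlgCl 2) = 0) ∧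
      (θ₂ ^ 2 + (q.coeff 1 : PadicAlgCl 2) * θ₂ + ((q.coeff 0 * q.coeff 2 : ℤ) : PadicAlgCl 2) = 0) := by
  set Δ : PadicAlgCl 2 := (q.coeff 1 : PadicAlgCl 2) ^ 2 - 4 * (q.coeff 0 : PadicAlgCl 2) * (q.coeff 2 : PadicAlgCl 2)
    with hΔ
  obtain ⟨s, hs⟩ := IsAlgClosed.exists_pow_nat_eq Δ (by norm_num : 0 < 2)
  have hΔ0 : Δ ≠ 0 := by
    have hQ := disc_ne_zero hq hnr
    have : Δ = algebraMap ℚ (PadicAlgCl 2) ((q.coeff 1 : ℚ) ^ 2 - 4 * (q.coeff 0 : ℚ) * (q.coeff 2 : ℚ)) := by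
      rw [hΔ]; simp
    rw [this]
    exact (map_ne_zero_iff _ (algebraMap ℚ (PadicAlgCl 2)).injective).mpr hQ
  have hs0 : s ≠ 0 := by rintro rfl; apply hΔ0; rw [← hs]; ring
  have h20 : (2 : PadicAlgCl 2) ≠ 0 := two_ne_zero
  set θ₁ : PadicAlgCl 2 := (-(q.coeff 1 : PadicAlgCl 2) + s) / 2 with hθ₁
  set θ₂ : PadicAlgCl 2 := (-(q.coeff 1 : PadicAlgCl 2) - s) / 2 with hθ₂
  have hsum : θ₁ + θ₂ = -(q.coeff 1 : PadicAlgCl 2) := by rw [hθ₁, hθ₂]; field_simp; ring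
  have hprod : θ₁ * θ₂ = (q.coeff 0 : PadicAlgCl 2) * (q.coeff 2 : PadicAlgCl 2) := by
    rw [hθ₁, hθ₂]; field_simp; linear_combination (-1 : PadicAlgCl 2) * hs
  have hroot : ∀ θ : PadicAlgCl 2, (θ = θ₁ ∨ θ = θ₂) →
      θ ^ 2 + (q.coeff 1 : PadicAlgCl 2) * θ + ((q.coeff 0 * q.coeff 2 : ℤ) : PadicAlgCl 2) = 0 := by
    intro θ hθ
    push_cast
    rcases hθ with rfl | rfl
    · linear_combination (θ₁) * hsum - hprod
    · linear_combination (θ₂) * hsum - hprod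
  have hr1 := hroot θ₁ (Or.inl rfl)
  have hr2 := hroot θ₂ (Or.inr rfl)
  have halg : ∀ θ : PadicAlgCl 2,
      θ ^ 2 + (q.coeff 1 : PadicAlgCl 2) * θ + ((q.coeff 0 * q.coeff 2 : ℤ) : PadicAlgCl 2) = 0 →
      IsAlgebraic ℚ θ := by
    intro θ hθ
    refine ⟨X ^ 2 + Polynomial.C (q.coeff 1 : ℚ) * X + Polynomial.C ((q.coeff 0 * q.coeff 2 : ℤ) : ℚ), ?_, ?_⟩
    · intro h0
      have := congrArg (fun p : ℚ[X] => p.coeff 2) h0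
      simp only [coeff_add, coeff_X_pow, coeff_C_mul, coeff_X, coeff_C, coeff_zero] at this
      norm_num at this
    · simp only [map_add, map_mul, map_pow, aeval_X, aeval_C]
      simpa using hθ
  refine ⟨θ₁, θ₂, hsum, hprod, ?_, normK_le_one_of_quadratic hr1, normK_le_one_of_quadratic hr2,
    halg θ₁ hr1, halg θ₂ hr2, hr1, hr2⟩
  intro h12
  apply hs0
  have : θ₁ - θ₂ = s := by rw [hθ₁, hθ₂]; field_simp; ring
  rw [← this, h12, sub_self]

/-- factorisation of the quadratic form in `𝕂`: `q₂ · Q(u,v) = (q₂u − θ₁v)(q₂u − θ₂v)`. -/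
theorem quadForm_factor {q : ℤ[X]} {θ₁ θ₂ : PadicAlgCl 2} (hsum : θ₁ + θ₂ = -(q.coeff 1 : PadicAlgCl 2))
    (hprod : θ₁ * θ₂ = (q.coeff 0 : PadicAlgCl 2) * (q.coeff 2 : PadicAlgCl 2)) (u v : ℤ) :
    (q.coeff 2 : PadicAlgCl 2) * ((hform q.coeff 2 u v : ℤ) : PadicAlgCl 2)
      = ((q.coeff 2 : PadicAlgCl 2) * u - θ₁ * v) * ((q.coeff 2 : PadicAlgCl 2) * u - θ₂ * v) := by
  rw [hform_intCast]
  simp only [hform, Finset.sum_range_succ, Finset.sum_range_zero, zero_add, pow_zero, mul_one,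
    Nat.sub_zero, Nat.sub_self, pow_one, show 2 - 1 = 1 from rfl]
  linear_combination ((q.coeff 2 : PadicAlgCl 2) * u * v) * hsum + (-((v : PadicAlgCl 2) ^ 2)) * hprod

/-- two factors with a separated difference and a small product: one of them is small. -/
theorem factor_small (A₁ A₂ : PadicAlgCl 2) {δ ε : ℝ} (hδ : 0 < δ) (hsep : δ ≤ ‖A₂ - A₁‖)
    (hprod : ‖A₁ * A₂‖ ≤ ε) : ‖A₁‖ ≤ ε / δ ∨ ‖A₂‖ ≤ ε / δ := by
  have hε : 0 ≤ ε := le_trans (norm_nonneg _) hprod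
  rw [norm_mul] at hprod
  have hmax : δ ≤ max ‖A₂‖ ‖A₁‖ := hsep.trans (normK_sub_le_max _ _)
  rcases le_max_iff.mp hmax with h2 | h1
  · left
    rw [le_div_iff₀ hδ]
    calc ‖A₁‖ * δ ≤ ‖A₁‖ * ‖A₂‖ := by gcongr
      _ ≤ ε := hprod
  · right
    rw [le_div_iff₀ hδ]
    calc ‖A₂‖ * δ ≤ ‖A₂‖ * ‖A₁‖ := by gcongr
      _ = ‖A₁‖ * ‖A₂‖ := mul_comm _ _
      _ ≤ ε := hprod

/-- [auxiliary] the scaled coefficient function `ĉᵢ = gᵢ q₂^{2a−i}` of `ĝ(X) = q₂^{2a} g(X/q₂)`. -/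
def ghatc (g q : ℤ[X]) (a : ℕ) : ℕ → ℤ := fun i => g.coeff i * q.coeff 2 ^ (2 * a - i)

/-- `ĝ(θ) = Σ ĉᵢ θⁱ ≠ 0` at a root `θ` of the monicised `q` (because `g ⊥ q`). -/
theorem ghat_ne_zero {g q : ℤ[X]} {a : ℕ} (hq : q.natDegree = 2) (hga : g.natDegree ≤ 2 * a)
    (hcop : ∀ z : ℂ, aeval z q = 0 → aeval z g ≠ 0) {θ : PadicAlgCl 2}
    (hθ : θ ^ 2 + (q.coeff 1 : PadicAlgCl 2) * θ + ((q.coeff 0 * q.coeff 2 : ℤ) : PadicAlgCl 2) = 0) :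
    hform (ghatc g q a) (2 * a) θ 1 ≠ 0 := by
  intro h0
  have h2 : (q.coeff 2 : PadicAlgCl 2) ≠ 0 := by exact_mod_cast coeff_two_ne_zero_of_natDegree hq
  set w : PadicAlgCl 2 := θ / (q.coeff 2 : PadicAlgCl 2) with hw
  have hθw : θ = (q.coeff 2 : PadicAlgCl 2) * w := by rw [hw]; field_simp
  -- `Σ gᵢ wⁱ = 0` (sums, not `aeval`: the `ℤ`-algebra structure on `𝕂` is not canonical syntactically)
  have hg : ∑ i ∈ Finset.range (2 * a + 1), (g.coeff i : PadicAlgCl 2) * w ^ i = 0 := by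
    have hs := hform_scale g.coeff (2 * a) (q.coeff 2) w (1 : PadicAlgCl 2)
    rw [← hθw] at hs
    change (q.coeff 2 : PadicAlgCl 2) ^ (2 * a) * hform g.coeff (2 * a) w 1 = hform (ghatc g q a) (2 * a) θ 1 at hs
    rw [h0, mul_eq_zero] at hs
    rcases hs with hs | hs
    · exact absurd hs (pow_ne_zero _ h2)
    · rw [← hs, hform]
      simp
  -- `Σ qᵢ wⁱ = 0`
  have hqw : ∑ i ∈ Finset.range (2 + 1), (q.coeff i : PadicAlgCl 2) * w ^ i = 0 := by
    have h1 : (q.coeff 2 : PadicAlgCl 2) * (∑ i ∈ Finset.range (2 + 1), (q.coeff i : PadicAlgCl 2) * w ^ i)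
        = θ ^ 2 + (q.coeff 1 : PadicAlgCl 2) * θ + ((q.coeff 0 * q.coeff 2 : ℤ) : PadicAlgCl 2) := by
      rw [hθw]; push_cast; simp only [Finset.sum_range_succ, Finset.sum_range_zero]; ring
    rw [hθ, mul_eq_zero] at h1
    rcases h1 with h1 | h1
    · exact absurd h1 h2
    · exact h1
  -- contradiction with Bezout
  obtain ⟨A, B, hAB⟩ := isCoprime_cpoly_of_hyp hq hga hcop
  have := congrArg (aeval w) hAB
  rw [map_add, map_mul, map_mul, map_one, aeval_cpoly, aeval_cpoly, hg, hqw, mul_zero, mul_zero,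
    add_zero] at this
  exact zero_ne_one this

end SplitGrades

end Summit.Schanuel.Schanuel.Theorems.RootDecomp1KLevelFinite

end
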